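import Mathlib.Combinatorics.SimpleGraph.Finite
import Mathlib.Combinatorics.SimpleGraph.Connectivity.Connected
import Mathlib.Data.Sym.Sym2.Order
import Mathlib.Data.ENat.Lattice
import Mathlib.Data.Real.Basic
import Mathlib.Data.List.Sublists
import Literature.Computability.Complexity.CNF
import HarnessLib

-- provenance: harness21/H21/H21/Prelude/CplxMeta/Resolution.lean @ 546175b (interim HEAD d8f2665); M5 mechanical rewrite
/-!
# Complexity meta: propositional resolution, its measures, and the hard formulas PHP / Tseitin

Trunk `CplxMeta`, concept C8 (outline `H21/Outlines/CplxMeta.md`, D2): the resolution proof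
system for CNFs (Krajíček, *Proof Complexity*, CUP 2019, Ch. 5), formalised at the math level
as **sequences of justified lines**. A line carries a clause (a `Finset` of literals of G01's
`Literal ν := ν × Bool`) together with the rule that produced it (`initial` clause of the CNF,
`resolve i j v` from earlier lines `i, j` on the pivot variable `v`, or `weaken i`). Validity of
a line sequence is a `Prop` (`IsResDerivation`), so sequence length is dag-like size, and the
premise indices give the underlying DAG, from which depth, (δ-)regularity and tree-likeness are
read off through small generic DAG helpers (`dagDepth`, `IsDagPath`).

We also define the two classical hard families over variables `ℕ`: the pigeonhole principle
`pigeonholeCNF m n = PHP^m_n` (Haken 1985) and the Tseitin contradictions `tseitinCNF G χ`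
(Tseitin 1968, Urquhart 1987).

## Mathlib search

Mathlib has no propositional resolution, no pigeonhole CNF and no Tseitin formulas (its
"resolutions" are homological). `Mathlib.Tactic.Sat.FromLRAT` reifies LRAT resolution proofs as
`Prop`s for a tactic and has no size/width/depth notions; not reused. We use `List.IsChain`
(DAG paths), `List.sublists` (local assignments in Tseitin clauses), `Sym2.inf`/`Sym2.sup`
(edge numbering), `SimpleGraph.incidenceFinset` (only in docstrings/statements) and `ℕ∞` infima.

## Design notes

* Clauses inside derivations are `Finset (Literal ν)` (sets, as in Krajíček Ch. 5), the input
  CNF is G01's list-based `CNF ν`, bridged by `CNF.clauseFinsets` (a dot-extension declared in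
  G01's namespace `Literature.Computability.Complexity.CNF`, so that `φ.clauseFinsets` works).
* `IsResDerivation φ π := ∀ k, IsValidResLine φ (π.take k) π[k]`: premise indices of line `k`
  point into the prefix `π.take k`, hence are `< k` on valid derivations.
* `dagDepth`, `IsDagPath`, `resDepth`, `pivotsAlong`, `IsRegular`, `IsDeltaRegular`,
  `IsTreeLike` are purely combinatorial functions of the premise lists; they are only
  meaningful on valid derivations and return harmless junk on invalid index data
  (out-of-range indices contribute depth `0` / no pivot).
* Weakening is included as a rule (Krajíček Ch. 5 allows it; it changes no measure by more than
  a constant factor and makes restrictions of refutations refutations).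
* Minimal refutation size is `ℕ∞`-valued (`⊤` iff no refutation exists, i.e. iff `φ` is
  satisfiable, `minResRefutationSize_lt_top_iff`).
* `pigeonholeCNF m 0` for `0 < m` consists of `m` copies of the EMPTY clause (a pigeon has no
  hole to go to), so it has a one-line refutation — consistent with Haken's `2^{Ω(n)}` at `n = 0`.
* `tseitinCNF` is computable: incident edges of `u` are listed as `s(u, w)` for the neighbours
  `w` in increasing order, and the forbidden local assignments are indexed by `List.sublists`
  (the set of incident edges set to `true`); as a set of clauses this is the textbook
  `{⋁_{e ∋ u} x_e^{1 - α(e)} : α ∈ {0,1}^{E(u)}, ⊕_e α(e) ≠ χ(u)}` over `G.incidenceFinset u`.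

## References

* J. Krajíček, *Proof Complexity*, CUP 2019, Ch. 5 (resolution R, R*, width, regular
  resolution), §13.1 (Tseitin formulas), Ch. 1 (PHP).
* A. Haken, *The intractability of resolution*, TCS 39 (1985) (PHP lower bound).
* E. Ben-Sasson, A. Wigderson, *Short proofs are narrow — resolution made simple*, J. ACM 48
  (2001), §2 (width, size–width relations).
* I. Bonacina, N. Talebanfard, *Strong ETH and resolution via games and the multiplicity of
  strategies*, Algorithmica 79 (2017), §1 (δ-regular resolution).
* A. Urquhart, *Hard examples for resolution*, J. ACM 34 (1987), §4 (Tseitin graph formulas,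
  Lemma 4.1).
* G. S. Tseitin, *On the complexity of derivation in propositional calculus*, 1968.
-/

namespace Literature.Computability.MetaComplexity

open _root_.Computability Complexity

variable {ν : Type*}

/-! ### Clauses as finite sets, resolvents -/

/-- The clauses of a CNF as finite sets of literals (duplicate literals merged, order
forgotten), the form in which resolution operates on them. Declared in G01's namespace
`Literature.Computability.Complexity.CNF` as a dot-extension so that `φ.clauseFinsets` elaborates.
[Krajíček 2019, §5.1 (clauses as sets of literals)] [folklore] -/
def _root_.Literature.Computability.Complexity.CNF.clauseFinsets [DecidableEq ν] (φ : CNF ν) :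
    List (Finset (Literal ν)) :=
  φ.map List.toFinset

/-- The set-clause `C` is true under `σ` iff some literal of `C` is. [Krajíček 2019, §5.1]
[folklore] -/
def finsetClauseEval (σ : ν → Bool) (C : Finset (Literal ν)) : Prop :=
  ∃ l ∈ C, l.eval σ = true

/-- `IsResolvent C D v E`: `E` is the resolvent of `C ∋ v` and `D ∋ ¬v` on the pivot `v`, i.e.
`E = (C ∖ {v}) ∪ (D ∖ {¬v})` (the resolution rule `C ∨ v, D ∨ ¬v ⊢ C ∨ D`).
[Krajíček 2019, §5.1, the resolution rule; Ben-Sasson–Wigderson 2001, §2.1]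
[cite: BenSassonWigderson2001, §2.1] -/
def IsResolvent [DecidableEq ν] (C D : Finset (Literal ν)) (v : ν) (E : Finset (Literal ν)) :
    Prop :=
  (v, true) ∈ C ∧ (v, false) ∈ D ∧ E = C.erase (v, true) ∪ D.erase (v, false)

/-! ### Lines, derivations, refutations -/

/-- The justification of a line of a resolution derivation: an initial clause (axiom) of the
CNF, the resolvent of earlier lines `i` and `j` on the pivot variable `pivot` (line `i`
contains the positive, line `j` the negative literal), or a weakening (superset) of earlier
line `i`. Indices refer to positions in the derivation. [Krajíček 2019, §5.1 (R with the
weakening rule)] [folklore] -/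
inductive ResRule (ν : Type*)
  /-- an initial clause of the refuted CNF -/
  | initial : ResRule ν
  /-- resolution of lines `i` (containing `pivot`) and `j` (containing `¬pivot`) -/
  | resolve (i j : ℕ) (pivot : ν) : ResRule ν
  /-- weakening of line `i` -/
  | weaken (i : ℕ) : ResRule ν
  deriving DecidableEq, Repr

/-- The premise indices of a rule application (`[]`, `[i, j]` or `[i]`).
[Krajíček 2019, §5.1] [folklore] -/
def ResRule.premises : ResRule ν → List ℕ
  | .initial => []
  | .resolve i j _ => [i, j]
  | .weaken i => [i]

/-- The pivot variable of a rule application, if it is a resolution step.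
[Krajíček 2019, §5.1] [folklore] -/
def ResRule.pivot? : ResRule ν → Option ν
  | .resolve _ _ v => some v
  | _ => none

/-- A line of a resolution derivation: a clause together with its justification.
[Krajíček 2019, §5.1; Cook–Reckhow 1979, §1 (proofs as annotated sequences)]
[cite: CookReckhow1979, §1 (proofs as annotated sequences)] -/
structure ResLine (ν : Type*) where
  /-- the clause derived at this line -/
  clause : Finset (Literal ν)
  /-- the rule application justifying it -/
  rule : ResRule ν

/-- The premise indices of a line. [Krajíček 2019, §5.1] [folklore] -/
def ResLine.premises (l : ResLine ν) : List ℕ :=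
  l.rule.premises

/-- Validity of a line `l` given the list `prev` of earlier lines and the CNF `φ` being refuted:
an `initial` line is a clause of `φ`; a `resolve i j v` line is the resolvent on `v` of earlier
lines `i, j < prev.length`; a `weaken i` line is a superset of earlier line `i`.
[Krajíček 2019, §5.1] [folklore] -/
def IsValidResLine [DecidableEq ν] (φ : CNF ν) (prev : List (ResLine ν)) (l : ResLine ν) :
    Prop :=
  match l.rule with
  | .initial => l.clause ∈ φ.clauseFinsets
  | .resolve i j v => ∃ hi : i < prev.length, ∃ hj : j < prev.length,
      IsResolvent (prev[i]'hi).clause (prev[j]'hj).clause v l.clause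
  | .weaken i => ∃ hi : i < prev.length, (prev[i]'hi).clause ⊆ l.clause

/-- `π` is a resolution derivation from `φ`: every line is valid with respect to the lines
before it. The length `π.length` is the (dag-like) *size* of the derivation.
[Krajíček 2019, §5.1 (R-derivations, size)] [folklore] -/
def IsResDerivation [DecidableEq ν] (φ : CNF ν) (π : List (ResLine ν)) : Prop :=
  ∀ k (hk : k < π.length), IsValidResLine φ (π.take k) (π[k]'hk)

/-- `π` is a resolution refutation of `φ`: a derivation from `φ` containing the empty clause.
[Krajíček 2019, §5.1 (R-refutations)] [folklore] -/
def IsResRefutation [DecidableEq ν] (φ : CNF ν) (π : List (ResLine ν)) : Prop :=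
  IsResDerivation φ π ∧ ∃ l ∈ π, l.clause = ∅

/-- Prefixes of derivations are derivations. [Krajíček 2019, §5.1] [folklore] -/
theorem IsResDerivation.take [DecidableEq ν] {φ : CNF ν} {π : List (ResLine ν)}
    (h : IsResDerivation φ π) (k : ℕ) : IsResDerivation φ (π.take k) := by
  intro j hj
  have hj' : j < k ∧ j < π.length := by simpa [List.length_take] using hj
  rw [List.take_take, min_eq_left hj'.1.le, List.getElem_take]
  exact h j hj'.2

/-- Soundness of resolution: a refuted CNF is unsatisfiable.
[Krajíček 2019, Thm 5.1.2] [cite: KrajicekProofComplexity2019, §5.1 (Thm. 5.1.2, soundness)] -/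
def not_satisfiable_of_isResRefutation : Prop :=
  ∀ [DecidableEq ν] {φ : CNF ν} {π : List (ResLine ν)} (h : IsResRefutation φ π),
    ¬ φ.Satisfiable

/-- Completeness of resolution: every unsatisfiable CNF (a finite list of clauses) has a
resolution refutation. [Krajíček 2019, Thm 5.1.2; Robinson 1965] [cite: Robinson1965] -/
def exists_isResRefutation_of_not_satisfiable : Prop :=
  ∀ [DecidableEq ν] {φ : CNF ν} (h : ¬ φ.Satisfiable),
    ∃ π : List (ResLine ν), IsResRefutation φ π

/-! ### Measures: width, depth, regularity, tree-likeness, minimal size -/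

/-- The width of a derivation: the maximal number of literals in one of its clauses (`0` for
the empty derivation). [Ben-Sasson–Wigderson 2001, §2.2; Krajíček 2019, §5.4]
[cite: BenSassonWigderson2001, §2.2] -/
def resWidth (π : List (ResLine ν)) : ℕ :=
  (π.map fun l => l.clause.card).foldr max 0

/-- Generic DAG helper. For a list `prem` of premise lists (node `k` has in-neighbours
`prem[k]`, all expected to be `< k`), the list of depths of the nodes: a node without premises
has depth `0`, otherwise `1 + ` the maximal depth of a premise. Computed left to right like
G01's `Circuit.depthVals`; a premise index not pointing to an earlier node contributes `0`
(junk, unreachable on valid derivations). [Krajíček 2019, §5.1 (height of a proof graph);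
Vollmer 1999, §1.2] [cite: Vollmer1999, §1.2] -/
def dagDepthList (prem : List (List ℕ)) : List ℕ :=
  prem.foldl (fun ds ps => ds ++ [(ps.map fun i => ds.getD i 0 + 1).foldr max 0]) []

/-- Generic DAG helper: the depth (height) of the DAG described by the premise lists `prem`,
i.e. the number of edges on a longest path (`0` for the empty DAG). Only meaningful when every
index in `prem[k]` is `< k` (valid derivations); harmless junk otherwise.
[Krajíček 2019, §5.1 (height); Urquhart 1995, §3 (depth of resolution proofs)]
[cite: Urquhart1995, §3 (depth of resolution proofs)] -/
def dagDepth (prem : List (List ℕ)) : ℕ :=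
  (dagDepthList prem).foldr max 0

/-- Generic DAG helper: `p` is a path in the DAG described by `prem`, followed from conclusions
to premises: all entries are node indices `< prem.length` and each next entry is a premise of
the previous one. Only meaningful on valid derivations (where indices strictly decrease along
a path). [Krajíček 2019, §5.1 (paths in the proof graph)] [folklore] -/
def IsDagPath (prem : List (List ℕ)) (p : List ℕ) : Prop :=
  (∀ i ∈ p, i < prem.length) ∧ p.IsChain fun a b => b ∈ prem.getD a []

/-- The depth of a resolution derivation: the longest premise chain (`dagDepth` of its premise
structure). Only meaningful on valid derivations. [Krajíček 2019, §5.1; Urquhart 1995, §3]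
[cite: Urquhart1995, §3] -/
def resDepth (π : List (ResLine ν)) : ℕ :=
  dagDepth (π.map ResLine.premises)

/-- The pivot variables of the resolution steps met along a list of line indices `p`
(non-resolution lines and out-of-range indices contribute nothing).
[Krajíček 2019, §5.6 (regular resolution)] [folklore] -/
def pivotsAlong (π : List (ResLine ν)) (p : List ℕ) : List ν :=
  p.filterMap fun i => π[i]?.bind fun l => l.rule.pivot?

/-- A derivation is *regular* if on every path of its DAG no variable is resolved upon twice.
Only meaningful on valid derivations. [Krajíček 2019, §5.6; Tseitin 1968] [cite: Tseitin1968] -/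
def IsRegular (π : List (ResLine ν)) : Prop :=
  ∀ p, IsDagPath (π.map ResLine.premises) p → (pivotsAlong π p).Nodup

/-- A derivation is *δ-regular* (with respect to `n` variables) if on every path of its DAG at
most `δ * n` distinct variables are resolved upon more than once (`δ = 0`: regular; `δ = 1`:
no restriction). Only meaningful on valid derivations.
[Bonacina–Talebanfard 2017, §1, Def. of δ-regular resolution]
[cite: BonacinaTalebanfard2017, §1, Def. of δ-regular resolution] -/
def IsDeltaRegular [DecidableEq ν] (δ : ℝ) (n : ℕ) (π : List (ResLine ν)) : Prop :=
  ∀ p, IsDagPath (π.map ResLine.premises) p →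
    ((((pivotsAlong π p).toFinset).filter fun v => 2 ≤ (pivotsAlong π p).count v).card : ℝ)
      ≤ δ * n

/-- Regular derivations are `δ`-regular for every `δ ≥ 0`. [Bonacina–Talebanfard 2017, §1]
[cite: BonacinaTalebanfard2017, §1] -/
theorem IsRegular.isDeltaRegular [DecidableEq ν] {π : List (ResLine ν)} (h : IsRegular π)
    {δ : ℝ} (hδ : 0 ≤ δ) (n : ℕ) : IsDeltaRegular δ n π := by
  intro p hp
  have hnd := h p hp
  have : ((pivotsAlong π p).toFinset.filter fun v => 2 ≤ (pivotsAlong π p).count v) = ∅ := by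
    refine Finset.filter_eq_empty_iff.2 fun v hv => ?_
    have := List.nodup_iff_count_le_one.1 hnd v
    omega
  rw [this, Finset.card_empty, Nat.cast_zero]
  positivity

/-- A derivation is *tree-like* if every line is used as a premise at most once (counted with
multiplicity), i.e. its proof DAG is a forest. [Krajíček 2019, §5.2 (R*, tree-like
resolution); Ben-Sasson–Wigderson 2001, §2] [cite: BenSassonWigderson2001, §2] -/
def IsTreeLike (π : List (ResLine ν)) : Prop :=
  ∀ i : ℕ, (π.map fun l => l.premises.count i).sum ≤ 1

/-- The minimal size (number of lines) of a resolution refutation of `φ`, in `ℕ∞`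
(`⊤` iff `φ` has no refutation, i.e. iff `φ` is satisfiable).
[Krajíček 2019, §5.1 (size `S_R(φ)`); Haken 1985] [cite: Haken1985] -/
noncomputable def minResRefutationSize [DecidableEq ν] (φ : CNF ν) : ℕ∞ :=
  ⨅ (π : List (ResLine ν)) (_ : IsResRefutation φ π), (π.length : ℕ∞)

/-- A refutation bounds the minimal refutation size. [Krajíček 2019, §5.1] [folklore] -/
theorem minResRefutationSize_le_length [DecidableEq ν] {φ : CNF ν} {π : List (ResLine ν)}
    (h : IsResRefutation φ π) : minResRefutationSize φ ≤ π.length :=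
  iInf₂_le π h

/-- The minimal refutation size is finite iff the CNF is unsatisfiable (soundness and
completeness of resolution).
[Krajíček 2019, Thm 5.1.2] [cite: KrajicekProofComplexity2019, §5.1 (Thm. 5.1.2)] -/
def minResRefutationSize_lt_top_iff : Prop :=
  ∀ [DecidableEq ν] (φ : CNF ν),
    minResRefutationSize φ < ⊤ ↔ ¬ φ.Satisfiable

/-! ### Hard formulas: the pigeonhole principle -/

/-- The pigeonhole CNF `PHP^m_n` over variables `ℕ` (`m` pigeons, `n` holes; unsatisfiable for
`n < m`). Variable `x_{ij}` ("pigeon `i` sits in hole `j`") is `i * n + j`. Clauses: the pigeon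
clauses `⋁_{j<n} x_{ij}` for `i < m` (first, in order of `i`), then the hole clauses
`¬x_{ij} ∨ ¬x_{i'j}` for `j < n` and `i < i' < m`. For `n = 0 < m` every pigeon clause is the
EMPTY clause, so `PHP^m_0` has a one-line refutation — consistent with Haken's `2^{Ω(n)}`
lower bound at `n = 0`. [Haken 1985, §1; Krajíček 2019, §1.1 (PHP_n)] [cite: Haken1985, §1] -/
def pigeonholeCNF (m n : ℕ) : CNF ℕ :=
  ((List.range m).map fun i => (List.range n).map fun j => (i * n + j, true)) ++
    (List.range n).flatMap fun j => (List.range m).flatMap fun i' =>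
      (List.range i').map fun i => [(i * n + j, false), (i' * n + j, false)]

/-- `PHP^m_n` has `m + n * (m choose 2)` clauses. [Haken 1985, §1] [cite: Haken1985, §1] -/
theorem length_pigeonholeCNF (m n : ℕ) :
    (pigeonholeCNF m n).length = m + n * m.choose 2 := by
  have h : ∀ m, (List.range m).sum = m.choose 2 := by
    intro m
    induction m with
    | zero => simp
    | succ m ih => simp [List.range_succ, Nat.choose_succ_succ, ih]; omega
  simp [pigeonholeCNF, List.length_flatMap, h, List.sum_replicate]

/-- `PHP^m_n` has width `max n 2`. [Haken 1985, §1; Ben-Sasson–Wigderson 2001, §4]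
[cite: Haken1985, §1] -/
theorem isWidthLE_pigeonholeCNF (m n : ℕ) : (pigeonholeCNF m n).IsWidthLE (max n 2) := by
  intro c hc
  simp only [pigeonholeCNF, List.mem_append, List.mem_map, List.mem_flatMap,
    List.mem_range] at hc
  rcases hc with ⟨i, -, rfl⟩ | ⟨j, -, i', -, i, -, rfl⟩
  · simp
  · simp

/-- The pigeonhole principle: `PHP^m_n` is unsatisfiable when there are more pigeons than
holes. [Haken 1985, §1; Krajíček 2019, §1.1] [cite: Haken1985, §1] -/
def pigeonholeCNF_not_satisfiable : Prop :=
  ∀ {m n : ℕ} (h : n < m),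
    ¬ (pigeonholeCNF m n).Satisfiable

/-! ### Hard formulas: Tseitin contradictions -/

section Tseitin

variable {v : ℕ}

/-- The variable number of an edge `e = s(a, b)` of a graph on `Fin v`:
`min a b * v + max a b` (injective on `Sym2 (Fin v)`). [Urquhart 1987, §4]
[cite: Urquhart1987, §4] -/
def tseitinEdgeVar (e : Sym2 (Fin v)) : ℕ :=
  (e.inf : ℕ) * v + (e.sup : ℕ)

/-- The neighbours of `u` in `G`, listed in increasing order. [Urquhart 1987, §4]
[cite: Urquhart1987, §4] -/
def tseitinNeighbors (G : SimpleGraph (Fin v)) [DecidableRel G.Adj] (u : Fin v) :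
    List (Fin v) :=
  (List.finRange v).filter fun w => G.Adj u w

/-- The Tseitin clauses at vertex `u` with charge `χ u`: for every set `S` of neighbours (the
incident edges `s(u, w)`, `w ∈ S`, being the ones set to `true`) whose parity `|S| mod 2`
differs from `χ u`, the clause falsified exactly by that local assignment, namely
`⋁_{w ∼ u} x_{s(u,w)}^{[w ∉ S]}`. There are `2^{deg(u) - 1}` such clauses (for `deg(u) ≥ 1`),
each of width `deg(u)`; as a set they range over the assignments of `G.incidenceFinset u` of the
wrong parity. [Urquhart 1987, §4; Krajíček 2019, §13.1] [cite: Urquhart1987, §4] -/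
def tseitinVertexClauses (G : SimpleGraph (Fin v)) [DecidableRel G.Adj] (χ : Fin v → Bool)
    (u : Fin v) : CNF ℕ :=
  ((tseitinNeighbors G u).sublists.filter fun S => S.length % 2 ≠ (χ u).toNat).map fun S =>
    (tseitinNeighbors G u).map fun w => (tseitinEdgeVar s(u, w), decide (w ∉ S))

/-- The Tseitin CNF `τ(G, χ)` of a finite graph `G` on `Fin v` with charge function `χ`: one
variable `x_e` per edge (numbered by `tseitinEdgeVar`), and for every vertex `u` the clauses
expressing `⊕_{e ∋ u} x_e = χ u`. Unsatisfiable iff some connected component has odd total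
charge. [Tseitin 1968; Urquhart 1987, §4; Krajíček 2019, §13.1] [cite: Tseitin1968] -/
def tseitinCNF (G : SimpleGraph (Fin v)) [DecidableRel G.Adj] (χ : Fin v → Bool) : CNF ℕ :=
  (List.finRange v).flatMap (tseitinVertexClauses G χ)

/-- Tseitin formulas with odd total charge are unsatisfiable (summing the vertex constraints,
every edge variable occurs twice). Connectivity of `G` is not needed for this direction.
[Urquhart 1987, Lemma 4.1; Krajíček 2019, Lemma 13.1.1] [cite: Urquhart1987, Lemma 4.1] -/
def tseitinCNF_not_satisfiable : Prop :=
  ∀ (G : SimpleGraph (Fin v)) [DecidableRel G.Adj] (χ : Fin v → Bool)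
    (hodd : Odd (Finset.univ.filter fun u => χ u = true).card),
    ¬ (tseitinCNF G χ).Satisfiable

/-- Urquhart's Lemma 4.1: for a connected graph, the Tseitin formula is satisfiable iff the
total charge is even. [Urquhart 1987, Lemma 4.1; Krajíček 2019, Lemma 13.1.1]
[cite: Urquhart1987, Lemma 4.1] -/
def tseitinCNF_satisfiable_iff : Prop :=
  ∀ (G : SimpleGraph (Fin v)) [DecidableRel G.Adj] (χ : Fin v → Bool) (hc : G.Connected),
    (tseitinCNF G χ).Satisfiable ↔ Even (Finset.univ.filter fun u => χ u = true).card

/-- Every clause of `τ(G, χ)` has width at most the maximum degree of `G`.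
[Urquhart 1987, §4; Ben-Sasson–Wigderson 2001, §5] [cite: Urquhart1987, §4] -/
def isWidthLE_tseitinCNF : Prop :=
  ∀ (G : SimpleGraph (Fin v)) [DecidableRel G.Adj] (χ : Fin v → Bool),
    (tseitinCNF G χ).IsWidthLE G.maxDegree

end Tseitin

end Literature.Computability.MetaComplexity
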